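import Summits.BirchSwinnertonDyer.Rank1Residual.GaloisImage.KolyvaginStalkSystem
import Summits.BirchSwinnertonDyer.Rank1Residual.GaloisImage.KolyvaginCoreTransport
import HarnessLib

/-!
# Kolyvagin systems of core rank one over `𝔽_p` are free of rank one: the ASSEMBLY of Rubin PCMI
# Cor. 2.8.9 (2) / Sakamoto 2024 Thm. 4.4 (1) at `m = 1` from existence (stalk half) and injectivity
# (graph half) (cell `b2b-bsdres`, team n1011, ROUTE-1 item R1-56 "S24(1) @ m = 1 in the kernel",
# row T-R1-56-S, FILE E = K5 assembly)

HONEST FRAMING (verbatim for the cell): research route; prove what is provable now; no claim beyond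
stated classes; nothing booked; no mark / label moved.  TOOL theorems about Kolyvagin systems of a
finite Galois module at the residual level `m = 1`; theorems only: no definition, no named fact, no
conjecture node.

## What

Setting = p11's R1-16 / T-R1-56-G binders (`K` a number field, `p` a prime, `M = T̄` finite killed by
`p`, a Poitou–Tate family `inv`, `𝓕` unramified outside `S` with finite Selmer and dual Selmer groups
and CORE RANK ONE, a Kolyvagin datum `D` with `𝒫 ∩ S = ∅`, admissible comparison maps and the local
shapes `#H¹_ur = #H¹_tr = p`, `H¹_ur ⊔ H¹_tr = ⊤` at `𝒫`, the residual self-duality `θ` with inverse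
`θ′`, and the two-class prime choice `hch` over `H¹(K, T̄)`).
* `exists_kolyvaginSystem_apply_eq_of_core` — SURJECTIVITY at every core vertex: every class of
  `H¹_{𝓕(n)}(K, M)` (`H^*(n) = 0`) is `κ_n` for some `κ ∈ KS₁` (the stalk half: FILE D4
  `Stalk.exists_isKolyvaginSystem_ne_zero_of_core` gives `κ^ε` with `κ^ε_n ≠ 0`, which generates the
  order-`p` group `H¹_{𝓕(n)}`; multiples of `κ^ε` do the rest);
* given INJECTIVITY at core vertices as the hypothesis `hinj` — the statement of p11's
  `CoreRankOne.apply_eq_zero_of_apply_core_eq_zero` (T-R1-56-G G5.2, Sakamoto §6 / MR04 §4.3: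
  connectedness of the core graph; to be supplied BY NAME when it lands, whereupon the corollary
  file drops `hinj`): `bijective_eval_of_core` (the `Function.Bijective` clause of the fact at
  `m = 1`, same `fun κ : D.kolyvaginSystems 𝓕 => ⟨κ.1 d, …⟩` term), `natCard_kolyvaginSystems_eq`
  (`#KS₁ = p`), **`isFreeRankOneZMod_kolyvaginSystems`** (`KS₁(M, 𝓕, 𝒫)` is free of rank one over
  `ℤ/p`) and the conjunction `isFreeRankOneZMod_and_bijective` in the shape of
  `Sakamoto2024.kolyvaginSystems_freeRankOne_zmod_three_pow_at 1`'s conclusion.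
Honest status: conditional on `hinj` (a THEOREM-shaped hypothesis, not a named fact; its producer is
the (G) half of the row).  Consumer: FILE F `SakamotoRankOneAtOne.lean` (the slice at `m = 1`).

References: K. Rubin, PCMI 18 (2011) Prop. 2.3.2, Thm. 2.8.8, Cor. 2.8.9 (pp. 19–25, held);
R. Sakamoto, JTNB 36 (2024) Thm. 4.4 (1), §6, Prop. 7.6 (held); B. Mazur, K. Rubin, JTNB 28 (2016)
Thm. 8.4, Thm. 8.7.
-/

noncomputable section

open scoped Classical NumberField ContRepresentation
open Function NumberField IsDedekindDomain
open Literature.NumberTheory.GaloisRepresentations Literature.NumberTheory.GaloisRepresentations.DiscreteGaloisModule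
  Literature.NumberTheory.GaloisCohomology
open Summit.BirchSwinnertonDyer.Rank1Residual.GaloisImage.CoreRankZero
open Summit.BirchSwinnertonDyer.Rank1Residual.X11b.Levels

universe u

namespace Summit.BirchSwinnertonDyer.Rank1Residual.GaloisImage.CoreRankOne

variable {K : Type u} [Field K] [NumberField K]
variable {M : Type u} [AddCommGroup M] [TopologicalSpace M] [DiscreteTopology M] [Finite M]
variable {ρ : DiscreteGaloisModule K M} {p : ℕ} [Fact p.Prime] {inv : LocalInvariants K p}
variable {S : Finset (Place K)} {𝓕 : SelmerStructure ρ} {D : KolyvaginDatum ρ}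
variable {θ : ρ.toContRepresentation →ⁱL (ρ.tateDual p).toContRepresentation}
  {θ' : (ρ.tateDual p).toContRepresentation →ⁱL ρ.toContRepresentation}

/-! ## §1. The one-class dual prime choice from the two-class choice over `H¹(K, T̄)` and `θ′` -/

omit [Fact p.Prime] in
/-- A non-zero class of `H¹(K, M^D)` is non-zero at infinitely many Kolyvagin primes, given the
two-class prime choice over `H¹(K, M)` and an equivariant `θ′ : M^D → M` with `θ ∘ θ′ = id` (transport
`y ↦ H¹(θ′) y`, naturality of localisation). [folklore] -/
theorem hprime'_of_hch (hθ'θ : ∀ b, θ (θ' b) = b)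
    (hch : ∀ c₁ c₂ : galoisCohomology ρ 1, c₁ ≠ 0 → c₂ ≠ 0 →
      {q ∈ D.primes | galoisCohomology.localization ρ (Sum.inr q) 1 c₁ ≠ 0 ∧
        galoisCohomology.localization ρ (Sum.inr q) 1 c₂ ≠ 0}.Infinite) :
    ∀ y : galoisCohomology (ρ.tateDual p) 1, y ≠ 0 →
      {q ∈ D.primes | galoisCohomology.localization (ρ.tateDual p) (Sum.inr q) 1 y ≠ 0}.Infinite := by
  intro y hy
  have hc : galoisCohomology.map θ' 1 y ≠ 0 := fun h =>
    hy (map_injective_of_comp_eq θ' θ hθ'θ (by rw [h, map_zero]))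
  refine (hch _ _ hc hc).mono ?_
  rintro q ⟨hq, hcq, -⟩
  refine ⟨hq, fun h0 => hcq ?_⟩
  rw [localization_map_one_eq, h0]
  exact map_zero _

/-! ## §2. Surjectivity at the core vertices (the stalk half) -/

/-- **Every class of `H¹_{𝓕(n)}(K, M)` at a core vertex `n` is the value `κ_n` of a Kolyvagin
system** (Rubin Thm. 2.8.8 / Cor. 2.8.9 (2), surjectivity, at `m = 1`): the Kolyvagin system `κ^ε` of
the stalk half is non-zero at `n`, hence generates the order-`p` group `H¹_{𝓕(n)}`, and `KS₁` is a
group. [folklore] -/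
theorem exists_kolyvaginSystem_apply_eq_of_core (hperf : inv.IsPerfect) (hsum : inv.SumLocalTermEqZero)
    (hcompl : inv.SelmerComplement) (hM : ∀ m : M, p • m = 0)
    (hS : ∀ v : HeightOneSpectrum (𝓞 K), (Sum.inr v : Place K) ∉ S →
      ((p : ℕ) : 𝓞 K) ∉ v.asIdeal ∧ GaloisRep.IsUnramifiedAt v ρ)
    (h𝓕 : 𝓕.IsUnramifiedOutside S) (hfin : Finite 𝓕.selmerGroup)
    (hfind : Finite (inv.dualSelmerStructure ρ 𝓕).selmerGroup)
    (hχ : LocalInvariants.HasCoreRank inv 𝓕 p 1)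
    (hPS : ∀ q ∈ D.primes, (Sum.inr q : Place K) ∉ S) (hadm : D.IsAdmissible)
    (hU : ∀ q ∈ D.primes, Nat.card (unramifiedSubgroup (GaloisRep.toLocal q ρ) 1) = p)
    (hT : ∀ q ∈ D.primes, Nat.card (D.transverse (Sum.inr q)) = p)
    (hUT : ∀ q ∈ D.primes,
      unramifiedSubgroup (GaloisRep.toLocal q ρ) 1 ⊔ D.transverse (Sum.inr q) = ⊤)
    (hθ'θ : ∀ b, θ (θ' b) = b)
    (hch : ∀ c₁ c₂ : galoisCohomology ρ 1, c₁ ≠ 0 → c₂ ≠ 0 →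
      {q ∈ D.primes | galoisCohomology.localization ρ (Sum.inr q) 1 c₁ ≠ 0 ∧
        galoisCohomology.localization ρ (Sum.inr q) 1 c₂ ≠ 0}.Infinite) :
    ∃ κ : Finset (HeightOneSpectrum (𝓞 K)) → galoisCohomology ρ 1, D.IsKolyvaginSystem 𝓕 κ ∧
      ∀ n, D.IsLevel n → (inv.dualSelmerStructure ρ (D.atLevel 𝓕 n)).selmerGroup = ⊥ →
        ∀ x ∈ (D.atLevel 𝓕 n).selmerGroup, ∃ m : ℤ, m • κ n = x := by
  have hp : p.Prime := Fact.out
  have hH1 : ∀ q ∈ D.primes, Nat.card (galoisCohomology (GaloisRep.toLocal q ρ) 1) = p ^ 2 :=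
    fun q hq => by
      haveI : Finite (galoisCohomology (GaloisRep.toLocal q ρ) 1) := finite_galoisCohomology_one_toLocal ρ q
      rw [natCard_galoisCohomology_toLocal_eq hadm hU hq, pow_two]
  have hUT' : ∀ q ∈ D.primes,
      unramifiedSubgroup (GaloisRep.toLocal q ρ) 1 ⊓ D.transverse (Sum.inr q) = ⊥ :=
    fun q hq => unramified_inf_transverse_eq_bot hadm hU hT hUT hq
  have hHcore : ∀ n, D.IsLevel n → (inv.dualSelmerStructure ρ (D.atLevel 𝓕 n)).selmerGroup = ⊥ →
      Nat.card (D.atLevel 𝓕 n).selmerGroup = p :=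
    fun n hn hc => natCard_selmerGroup_atLevel_of_core hperf hsum hcompl hM hS h𝓕 hfin hfind hχ hPS hU hT
      hn hc
  obtain ⟨κ, hκ, hne⟩ := Stalk.exists_isKolyvaginSystem_ne_zero_of_core p hperf hsum hcompl hM hS h𝓕
    hfin hfind hχ hPS hadm hU hUT hUT' hH1 (hprime'_of_hch hθ'θ hch) hHcore
  refine ⟨κ, hκ, fun n hn hcore x hx => ?_⟩
  -- `κ_n` generates the order-`p` group `H¹_{𝓕(n)}`
  have hgen := eq_zmultiples_of_natCard_eq_prime hp (hHcore n hn hcore) (hκ.mem_selmerGroup n hn)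
    (hne n hn hcore)
  have hx' : x ∈ AddSubgroup.zmultiples (κ n) := hgen ▸ hx
  obtain ⟨m, hm⟩ := AddSubgroup.mem_zmultiples_iff.mp hx'
  exact ⟨m, hm⟩

/-! ## §3. Assembly with injectivity: bijectivity at core vertices, `#KS₁ = p`, free of rank one -/

/-- **Bijectivity of `κ ↦ κ_n` at every core vertex**, given the injectivity statement `hinj` of the
graph half (p11's `apply_eq_zero_of_apply_core_eq_zero`): the `Function.Bijective` clause of
`Sakamoto2024.kolyvaginSystems_freeRankOne_zmod_three_pow` at `m = 1` (same term). [folklore] -/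
theorem bijective_eval_of_core (hperf : inv.IsPerfect) (hsum : inv.SumLocalTermEqZero)
    (hcompl : inv.SelmerComplement) (hM : ∀ m : M, p • m = 0)
    (hS : ∀ v : HeightOneSpectrum (𝓞 K), (Sum.inr v : Place K) ∉ S →
      ((p : ℕ) : 𝓞 K) ∉ v.asIdeal ∧ GaloisRep.IsUnramifiedAt v ρ)
    (h𝓕 : 𝓕.IsUnramifiedOutside S) (hfin : Finite 𝓕.selmerGroup)
    (hfind : Finite (inv.dualSelmerStructure ρ 𝓕).selmerGroup)
    (hχ : LocalInvariants.HasCoreRank inv 𝓕 p 1)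
    (hPS : ∀ q ∈ D.primes, (Sum.inr q : Place K) ∉ S) (hadm : D.IsAdmissible)
    (hU : ∀ q ∈ D.primes, Nat.card (unramifiedSubgroup (GaloisRep.toLocal q ρ) 1) = p)
    (hT : ∀ q ∈ D.primes, Nat.card (D.transverse (Sum.inr q)) = p)
    (hUT : ∀ q ∈ D.primes,
      unramifiedSubgroup (GaloisRep.toLocal q ρ) 1 ⊔ D.transverse (Sum.inr q) = ⊤)
    (hθ'θ : ∀ b, θ (θ' b) = b)
    (hch : ∀ c₁ c₂ : galoisCohomology ρ 1, c₁ ≠ 0 → c₂ ≠ 0 →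
      {q ∈ D.primes | galoisCohomology.localization ρ (Sum.inr q) 1 c₁ ≠ 0 ∧
        galoisCohomology.localization ρ (Sum.inr q) 1 c₂ ≠ 0}.Infinite)
    (hinj : ∀ κ, D.IsKolyvaginSystem 𝓕 κ → ∀ n₀, D.IsLevel n₀ →
      (inv.dualSelmerStructure ρ (D.atLevel 𝓕 n₀)).selmerGroup = ⊥ → κ n₀ = 0 → ∀ n, κ n = 0)
    {d : Finset (HeightOneSpectrum (𝓞 K))} (hd : D.IsLevel d)
    (hcore : (inv.dualSelmerStructure ρ (D.atLevel 𝓕 d)).selmerGroup = ⊥) :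
    Function.Bijective fun κ : D.kolyvaginSystems 𝓕 =>
      (⟨κ.1 d, ((KolyvaginDatum.mem_kolyvaginSystems_iff D 𝓕 κ.1).mp κ.2).mem_selmerGroup d hd⟩ :
        (D.atLevel 𝓕 d).selmerGroup) := by
  constructor
  · intro κ₁ κ₂ h
    have h' : κ₁.1 d = κ₂.1 d := congrArg Subtype.val h
    have hsub : (κ₁ - κ₂ : D.kolyvaginSystems 𝓕).1 d = 0 := by
      rw [AddSubgroupClass.coe_sub, Pi.sub_apply, h', sub_self]
    have hall := hinj _ ((KolyvaginDatum.mem_kolyvaginSystems_iff D 𝓕 _).mp (κ₁ - κ₂).2) d hd hcore hsub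
    have : (κ₁ - κ₂ : D.kolyvaginSystems 𝓕) = 0 := Subtype.ext (funext fun n => hall n)
    exact sub_eq_zero.mp this
  · rintro ⟨x, hx⟩
    obtain ⟨κ, hκ, hsurj⟩ := exists_kolyvaginSystem_apply_eq_of_core hperf hsum hcompl hM hS h𝓕 hfin
      hfind hχ hPS hadm hU hT hUT hθ'θ hch
    obtain ⟨m, hm⟩ := hsurj d hd hcore x hx
    refine ⟨⟨m • κ, AddSubgroup.zsmul_mem _ ((KolyvaginDatum.mem_kolyvaginSystems_iff D 𝓕 κ).mpr hκ) m⟩,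
      Subtype.ext ?_⟩
    exact hm

/-- **`#KS₁(M, 𝓕, 𝒫) = p`** given `hinj` (bijection with the order-`p` group `H¹_{𝓕(d)}` at a core
vertex `d`, which exists above `∅` by p11's `exists_core_superset`). [folklore] -/
theorem natCard_kolyvaginSystems_eq (hperf : inv.IsPerfect) (hsum : inv.SumLocalTermEqZero)
    (hcompl : inv.SelmerComplement) (hM : ∀ m : M, p • m = 0)
    (hS : ∀ v : HeightOneSpectrum (𝓞 K), (Sum.inr v : Place K) ∉ S →
      ((p : ℕ) : 𝓞 K) ∉ v.asIdeal ∧ GaloisRep.IsUnramifiedAt v ρ)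
    (h𝓕 : 𝓕.IsUnramifiedOutside S) (hfin : Finite 𝓕.selmerGroup)
    (hfind : Finite (inv.dualSelmerStructure ρ 𝓕).selmerGroup)
    (hχ : LocalInvariants.HasCoreRank inv 𝓕 p 1)
    (hPS : ∀ q ∈ D.primes, (Sum.inr q : Place K) ∉ S) (hadm : D.IsAdmissible)
    (hU : ∀ q ∈ D.primes, Nat.card (unramifiedSubgroup (GaloisRep.toLocal q ρ) 1) = p)
    (hT : ∀ q ∈ D.primes, Nat.card (D.transverse (Sum.inr q)) = p)
    (hUT : ∀ q ∈ D.primes,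
      unramifiedSubgroup (GaloisRep.toLocal q ρ) 1 ⊔ D.transverse (Sum.inr q) = ⊤)
    (hθ'θ : ∀ b, θ (θ' b) = b)
    (hch : ∀ c₁ c₂ : galoisCohomology ρ 1, c₁ ≠ 0 → c₂ ≠ 0 →
      {q ∈ D.primes | galoisCohomology.localization ρ (Sum.inr q) 1 c₁ ≠ 0 ∧
        galoisCohomology.localization ρ (Sum.inr q) 1 c₂ ≠ 0}.Infinite)
    (hinj : ∀ κ, D.IsKolyvaginSystem 𝓕 κ → ∀ n₀, D.IsLevel n₀ →
      (inv.dualSelmerStructure ρ (D.atLevel 𝓕 n₀)).selmerGroup = ⊥ → κ n₀ = 0 → ∀ n, κ n = 0) :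
    Nat.card (D.kolyvaginSystems 𝓕) = p := by
  obtain ⟨d, -, hd, hcore⟩ := exists_core_superset hperf hsum hcompl hM hS h𝓕 hfin hfind hχ hPS hU hT hUT
    (hprime_of_localization_pair_infinite θ θ' hθ'θ hch) D.isLevel_empty
  rw [Nat.card_eq_of_bijective _ (bijective_eval_of_core hperf hsum hcompl hM hS h𝓕 hfin hfind hχ hPS hadm
    hU hT hUT hθ'θ hch hinj hd hcore)]
  exact natCard_selmerGroup_atLevel_of_core hperf hsum hcompl hM hS h𝓕 hfin hfind hχ hPS hU hT hd hcore

/-- **`KS₁(M, 𝓕, 𝒫)` is free of rank one over `ℤ/p`** given `hinj` (Rubin PCMI Cor. 2.8.9 (2) / [S24]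
Thm. 4.4 (1) first clause, at `m = 1`). [folklore] -/
theorem isFreeRankOneZMod_kolyvaginSystems (hperf : inv.IsPerfect) (hsum : inv.SumLocalTermEqZero)
    (hcompl : inv.SelmerComplement) (hM : ∀ m : M, p • m = 0)
    (hS : ∀ v : HeightOneSpectrum (𝓞 K), (Sum.inr v : Place K) ∉ S →
      ((p : ℕ) : 𝓞 K) ∉ v.asIdeal ∧ GaloisRep.IsUnramifiedAt v ρ)
    (h𝓕 : 𝓕.IsUnramifiedOutside S) (hfin : Finite 𝓕.selmerGroup)
    (hfind : Finite (inv.dualSelmerStructure ρ 𝓕).selmerGroup)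
    (hχ : LocalInvariants.HasCoreRank inv 𝓕 p 1)
    (hPS : ∀ q ∈ D.primes, (Sum.inr q : Place K) ∉ S) (hadm : D.IsAdmissible)
    (hU : ∀ q ∈ D.primes, Nat.card (unramifiedSubgroup (GaloisRep.toLocal q ρ) 1) = p)
    (hT : ∀ q ∈ D.primes, Nat.card (D.transverse (Sum.inr q)) = p)
    (hUT : ∀ q ∈ D.primes,
      unramifiedSubgroup (GaloisRep.toLocal q ρ) 1 ⊔ D.transverse (Sum.inr q) = ⊤)
    (hθ'θ : ∀ b, θ (θ' b) = b)
    (hch : ∀ c₁ c₂ : galoisCohomology ρ 1, c₁ ≠ 0 → c₂ ≠ 0 →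
      {q ∈ D.primes | galoisCohomology.localization ρ (Sum.inr q) 1 c₁ ≠ 0 ∧
        galoisCohomology.localization ρ (Sum.inr q) 1 c₂ ≠ 0}.Infinite)
    (hinj : ∀ κ, D.IsKolyvaginSystem 𝓕 κ → ∀ n₀, D.IsLevel n₀ →
      (inv.dualSelmerStructure ρ (D.atLevel 𝓕 n₀)).selmerGroup = ⊥ → κ n₀ = 0 → ∀ n, κ n = 0) :
    KolyvaginSystem.IsFreeRankOneZMod (D.kolyvaginSystems 𝓕) p :=
  ⟨addEquivOfPrimeCardEq (natCard_kolyvaginSystems_eq hperf hsum hcompl hM hS h𝓕 hfin hfind hχ hPS hadm hU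
    hT hUT hθ'θ hch hinj) (Nat.card_zmod p)⟩

/-- **[S24] Thm. 4.4 (1) at `m = 1`, conclusion shape, given `hinj`**: `KS₁(M, 𝓕, 𝒫)` is free of rank
one over `ℤ/p` AND `κ ↦ κ_d` is bijective onto `H¹_{𝓕(d)}(K, M)` at every level `d` with
`H¹_{𝓕(d)^*}(K, M^D) = 0` — the two clauses of
`Sakamoto2024.kolyvaginSystems_freeRankOne_zmod_three_pow_at 1` on a single module. [folklore] -/
theorem isFreeRankOneZMod_and_bijective (hperf : inv.IsPerfect) (hsum : inv.SumLocalTermEqZero)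
    (hcompl : inv.SelmerComplement) (hM : ∀ m : M, p • m = 0)
    (hS : ∀ v : HeightOneSpectrum (𝓞 K), (Sum.inr v : Place K) ∉ S →
      ((p : ℕ) : 𝓞 K) ∉ v.asIdeal ∧ GaloisRep.IsUnramifiedAt v ρ)
    (h𝓕 : 𝓕.IsUnramifiedOutside S) (hfin : Finite 𝓕.selmerGroup)
    (hfind : Finite (inv.dualSelmerStructure ρ 𝓕).selmerGroup)
    (hχ : LocalInvariants.HasCoreRank inv 𝓕 p 1)
    (hPS : ∀ q ∈ D.primes, (Sum.inr q : Place K) ∉ S) (hadm : D.IsAdmissible)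
    (hU : ∀ q ∈ D.primes, Nat.card (unramifiedSubgroup (GaloisRep.toLocal q ρ) 1) = p)
    (hT : ∀ q ∈ D.primes, Nat.card (D.transverse (Sum.inr q)) = p)
    (hUT : ∀ q ∈ D.primes,
      unramifiedSubgroup (GaloisRep.toLocal q ρ) 1 ⊔ D.transverse (Sum.inr q) = ⊤)
    (hθ'θ : ∀ b, θ (θ' b) = b)
    (hch : ∀ c₁ c₂ : galoisCohomology ρ 1, c₁ ≠ 0 → c₂ ≠ 0 →
      {q ∈ D.primes | galoisCohomology.localization ρ (Sum.inr q) 1 c₁ ≠ 0 ∧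
        galoisCohomology.localization ρ (Sum.inr q) 1 c₂ ≠ 0}.Infinite)
    (hinj : ∀ κ, D.IsKolyvaginSystem 𝓕 κ → ∀ n₀, D.IsLevel n₀ →
      (inv.dualSelmerStructure ρ (D.atLevel 𝓕 n₀)).selmerGroup = ⊥ → κ n₀ = 0 → ∀ n, κ n = 0) :
    KolyvaginSystem.IsFreeRankOneZMod (D.kolyvaginSystems 𝓕) p ∧
      ∀ (d : Finset (HeightOneSpectrum (𝓞 K))) (hd : D.IsLevel d),
        (inv.dualSelmerStructure ρ (D.atLevel 𝓕 d)).selmerGroup = ⊥ →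
        Function.Bijective fun κ : D.kolyvaginSystems 𝓕 =>
          (⟨κ.1 d, ((KolyvaginDatum.mem_kolyvaginSystems_iff D 𝓕 κ.1).mp κ.2).mem_selmerGroup d hd⟩ :
            (D.atLevel 𝓕 d).selmerGroup) :=
  ⟨isFreeRankOneZMod_kolyvaginSystems hperf hsum hcompl hM hS h𝓕 hfin hfind hχ hPS hadm hU hT hUT hθ'θ hch
      hinj,
    fun _ hd hcore => bijective_eval_of_core hperf hsum hcompl hM hS h𝓕 hfin hfind hχ hPS hadm hU hT hUT
      hθ'θ hch hinj hd hcore⟩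

end Summit.BirchSwinnertonDyer.Rank1Residual.GaloisImage.CoreRankOne

end
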